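import Literature.Probability.Independence.HoeffdingDecompositionParts
import Literature.Probability.Independence.HoeffdingDecompositionTransport
import HarnessLib

/-!
# FlatTubeReduction / `PinnedUnitStepEx` (stmt-QuantumFields-27561) — the OMISSION LEMMA (multiplicity lemma of W-inj at `m = 1`)

Seat ym-line-fcl-p3 g9 (2026-08-28).  Route `route-QuantumFields-FlatTubeReduction`, crux `PinnedUnitStepEx` (planner ym-idea-1 g6, line
«ti-split-1», skeleton `Cruxes/PinnedUnitStepEx` / HOME `PUnitEx_tisplit1.lean`); this file serves its kinematic stub
`stub_smearVarPosGS1 : SmearVarPosGS1` («W-inj at one doubled slab»: the fine-translation average of the thinning pull-back of a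
translation-invariant coarse observable is not a.e. constant).  R2b1 is a RECORD rung; nothing here is a summit, a crux or the stub itself.

Paper proof: evidence `WINJ-m1-proof-fcl-p3-g9.md` on the item, §P6.  After the Hoeffding decomposition (`Literature.Probability.Independence.
Hoeffding`, landed for this purpose) and the change of variables to partial products along a contractible run, the «same-orbit collisions»
of the smear reduce to the following statement, proved here WITHOUT any representation theory:

* `ae_eq_zero_of_sum_comp_eq_zero` (abstract form).  `K` finite, `e k : ι → ι'` injections of finite index sets, `k₀ ∈ K`, and a weight
  `wt : ι' → ℕ` with `wt (e k i) ≤ wt (e k₀ i)`, equality forcing `e k i = e k₀ i`.  If `H` is bounded measurable on `ι → β` (product of a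
  probability space) and `Σ_k H(V ∘ e k) = 0` for a.e. `V : ι' → β`, then `H = 0` a.e.  (Proof: decompose `H = Σ_Q H^{=Q}`; regroup
  `Σ_k Σ_Q H^{=Q}∘(·∘e k)` by fine support and apply uniqueness of the decomposition on `ι'`; take `Q₀` with `H^{=Q₀} ≠ 0` maximising
  `ψ(Q) = Σ_{i∈Q} wt(e k₀ i)`; at the fine support `e k₀ (Q₀)` every contributing `(k, Q)` has `Q = Q₀`, `e k = e k₀` on `Q₀`, hence the SAME
  term, or `H^{=Q} = 0` a.e.; so `N · H^{=Q₀}∘(·∘e k₀) = 0` a.e. with `N ≥ 1` — contradiction.)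
* `ae_eq_zero_of_sum_omit_eq_zero` (the run instance).  Index sets `(Y × Fin r) ⊕ Z` ↪ `(Y × Fin (r+1)) ⊕ Z` by `Fin.succAbove k.castSucc` on the
  column coordinate («omit partial product number `k`», `k < r`; the total product, column `r`, is never omitted), weight `2^{column}`:
  `Σ_{k<r} H(V with column k omitted) = 0` a.e. ⇒ `H = 0` a.e. (`r ≥ 1`).
-/

set_option autoImplicit false

noncomputable section

open MeasureTheory Finset Function
open Literature.Probability.Independence.Hoeffding

namespace Summit.QuantumFields.YangMills.Theorems.FlatTubeReduction.Omission

variable {ι ι' : Type*} [Fintype ι] [DecidableEq ι] [Fintype ι'] [DecidableEq ι']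
variable {β : Type*} [MeasurableSpace β] {μ : Measure β} [IsProbabilityMeasure μ]

/-- Pull-back along an injection of index sets preserves AND reflects a.e.-nullity (bounded measurable functions; the pull-back
map marginalises the probability product). [folklore] -/
theorem comp_ae_eq_zero_iff {e : ι → ι'} (he : Injective e) {g : (ι → β) → ℝ} (hg : Measurable g) {C : ℝ}
    (hC : ∀ x, |g x| ≤ C) :
    (fun V : ι' → β => g (V ∘ e)) =ᵐ[Measure.pi fun _ : ι' => μ] 0 ↔ g =ᵐ[Measure.pi fun _ : ι => μ] 0 := by
  have habs : Measurable fun x => |g x| := hg.abs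
  have hCabs : ∀ x, |(fun x => |g x|) x| ≤ C := fun x => by simpa using hC x
  have hint : ∫ V, |g (V ∘ e)| ∂(Measure.pi fun _ : ι' => μ) = ∫ x, |g x| ∂(Measure.pi fun _ : ι => μ) :=
    integral_comp_of_injective (f := fun x => |g x|) he habs hCabs
  have hi1 : Integrable (fun x => |g x|) (Measure.pi fun _ : ι => μ) :=
    Integrable.mono' (integrable_const C) habs.aestronglyMeasurable
      (Filter.Eventually.of_forall fun x => by rw [Real.norm_eq_abs]; exact hCabs x)
  have hi2 : Integrable (fun V : ι' → β => |g (V ∘ e)|) (Measure.pi fun _ : ι' => μ) :=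
    Integrable.mono' (integrable_const C) (measurable_comp_restrict habs).aestronglyMeasurable
      (Filter.Eventually.of_forall fun x => by rw [Real.norm_eq_abs]; exact hCabs _)
  constructor
  · intro h
    have h0 : ∫ V, |g (V ∘ e)| ∂(Measure.pi fun _ : ι' => μ) = 0 := by
      rw [integral_congr_ae (g := fun _ => (0 : ℝ)) (h.mono fun V hV => by
        have hV' : g (V ∘ e) = 0 := hV
        change |g (V ∘ e)| = (0 : ℝ)
        rw [hV', abs_zero])]
      simp
    rw [hint] at h0
    have := (integral_eq_zero_iff_of_nonneg (fun x => abs_nonneg _) hi1).1 h0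
    exact this.mono fun x hx => by simpa using hx
  · intro h
    have h0 : ∫ x, |g x| ∂(Measure.pi fun _ : ι => μ) = 0 := by
      rw [integral_congr_ae (g := fun _ => (0 : ℝ)) (h.mono fun x hx => by
        have hx' : g x = 0 := hx
        change |g x| = (0 : ℝ)
        rw [hx', abs_zero])]
      simp
    rw [← hint] at h0
    have := (integral_eq_zero_iff_of_nonneg (fun V => abs_nonneg _) hi2).1 h0
    exact this.mono fun V hV => by simpa using hV

/-- **The omission lemma, abstract form.**  See the module docstring. [folklore] -/
theorem ae_eq_zero_of_sum_comp_eq_zero {K : Type*} [Fintype K] [DecidableEq K] (e : K → ι → ι')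
    (he : ∀ k, Injective (e k)) (k₀ : K) (wt : ι' → ℕ) (hle : ∀ k i, wt (e k i) ≤ wt (e k₀ i))
    (heq : ∀ k i, wt (e k i) = wt (e k₀ i) → e k i = e k₀ i)
    {H : (ι → β) → ℝ} (hH : Measurable H) {C : ℝ} (hC : ∀ x, |H x| ≤ C)
    (hsum : (fun V : ι' → β => ∑ k, H (V ∘ e k)) =ᵐ[Measure.pi fun _ : ι' => μ] 0) :
    H =ᵐ[Measure.pi fun _ : ι => μ] 0 := by
  classical
  set P := Measure.pi fun _ : ι => μ with hP
  set P' := Measure.pi fun _ : ι' => μ with hP'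
  -- the pulled-back parts
  let G : K → Finset ι → (ι' → β) → ℝ := fun k Q V => esPart μ Q H (V ∘ e k)
  have hGm : ∀ k Q, Measurable (G k Q) := fun k Q => measurable_comp_restrict (measurable_esPart Q hH)
  have hGb : ∀ k Q V, |G k Q V| ≤ 2 ^ (Fintype.card ι) * C := fun k Q V => by
    refine (abs_esPart_le Q hC _).trans ?_
    have hC0 : 0 ≤ C := (abs_nonneg _).trans (hC (V ∘ e k))
    exact mul_le_mul_of_nonneg_right (pow_le_pow_right₀ one_le_two (Finset.card_le_univ Q)) hC0
  have hGnull : ∀ k Q, esPart μ Q H =ᵐ[P] 0 → G k Q =ᵐ[P'] 0 := fun k Q h0 =>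
    (comp_ae_eq_zero_iff (he k) (measurable_esPart Q hH) (abs_esPart_le Q hC)).2 h0
  -- regrouping by fine support
  let h : Finset ι' → (ι' → β) → ℝ := fun Q' V => ∑ k, ∑ Q ∈ univ.filter (fun Q => Q.image (e k) = Q'), G k Q V
  have hh0 : ∀ Q', h Q' =ᵐ[P'] 0 := by
    refine ae_eq_zero_of_sum_parts h (fun Q' => ?_) (fun Q' => ?_) (fun Q' => ?_) (fun Q' => ?_) ?_
    · exact Finset.measurable_sum _ fun k _ => Finset.measurable_sum _ fun Q _ => hGm k Q
    · refine ⟨∑ k : K, ∑ Q : Finset ι, 2 ^ (Fintype.card ι) * C, fun V => ?_⟩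
      refine (Finset.abs_sum_le_sum_abs _ _).trans (Finset.sum_le_sum fun k _ => ?_)
      refine (Finset.abs_sum_le_sum_abs _ _).trans ?_
      calc ∑ Q ∈ univ.filter (fun Q => Q.image (e k) = Q'), |G k Q V|
          ≤ ∑ Q ∈ univ.filter (fun Q => Q.image (e k) = Q'), 2 ^ (Fintype.card ι) * C :=
            Finset.sum_le_sum fun Q _ => hGb k Q V
        _ ≤ ∑ Q : Finset ι, 2 ^ (Fintype.card ι) * C :=
            Finset.sum_le_sum_of_subset_of_nonneg (Finset.filter_subset _ _) fun Q _ _ =>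
              mul_nonneg (pow_nonneg zero_le_two _) ((abs_nonneg _).trans (hC (V ∘ e k)))
    · -- depends only on `Q'`
      intro V W hVW
      refine Finset.sum_congr rfl fun k _ => Finset.sum_congr rfl fun Q hQ => ?_
      rw [Finset.mem_filter] at hQ
      refine dependsOff_comp_of_injective (B := univ \ Q) (dependsOff_esPart Q H) (fun i hi => ?_) V W hVW
      rw [Finset.mem_sdiff] at hi ⊢
      exact ⟨Finset.mem_univ _, fun hiQ => hi.2 (hQ.2 ▸ Finset.mem_image_of_mem _ hiQ)⟩
    · -- exact in every coordinate of `Q'` (pointwise)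
      intro j hj
      refine Filter.Eventually.of_forall fun V => ?_
      change condAvg μ {j} (fun V => ∑ k, ∑ Q ∈ univ.filter (fun Q => Q.image (e k) = Q'), G k Q V) V = 0
      rw [condAvg_finset_sum _ _ _ (fun k _ => Finset.measurable_sum _ fun Q _ => hGm k Q)
        (fun k _ => ⟨∑ Q : Finset ι, 2 ^ (Fintype.card ι) * C, fun V =>
          (Finset.abs_sum_le_sum_abs _ _).trans ((Finset.sum_le_sum fun Q _ => hGb k Q V).trans
            (Finset.sum_le_sum_of_subset_of_nonneg (Finset.filter_subset _ _) fun Q _ _ =>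
              mul_nonneg (pow_nonneg zero_le_two _) ((abs_nonneg _).trans (hC (V ∘ e k)))))⟩)]
      refine Finset.sum_eq_zero fun k _ => ?_
      rw [condAvg_finset_sum _ _ _ (fun Q _ => hGm k Q) (fun Q _ => ⟨_, hGb k Q⟩)]
      refine Finset.sum_eq_zero fun Q hQ => ?_
      rw [Finset.mem_filter] at hQ
      obtain ⟨i, hiQ, rfl⟩ := Finset.mem_image.1 (hQ.2 ▸ hj : j ∈ Q.image (e k))
      have := condAvg_comp_image (μ := μ) (he k) (measurable_esPart (μ := μ) Q hH) (abs_esPart_le (μ := μ) Q hC) {i} V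
      rw [Finset.image_singleton] at this
      change condAvg μ {e k i} (fun z' => esPart μ Q H (z' ∘ e k)) V = 0
      rw [this, condAvg_esPart_eq_zero (μ := μ) (Finset.mem_singleton_self i) hiQ hH hC]
    · -- the regrouped sum is `Σ_k H ∘ (·∘e k)`
      have hre : ∀ V, ∑ Q', h Q' V = ∑ k, H (V ∘ e k) := by
        intro V
        change ∑ Q', ∑ k, ∑ Q ∈ univ.filter (fun Q => Q.image (e k) = Q'), G k Q V = _
        rw [Finset.sum_comm]
        refine Finset.sum_congr rfl fun k _ => ?_
        rw [Finset.sum_fiberwise univ (fun Q : Finset ι => Q.image (e k)) fun Q => G k Q V]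
        exact sum_esPart H (V ∘ e k)
      refine hsum.mono fun V hV => ?_
      have hV' : ∑ k, H (V ∘ e k) = 0 := hV
      show ∑ T, h T V = (0 : (ι' → β) → ℝ) V
      rw [hre V, hV']
      rfl
  -- the extremal argument
  let ψ : Finset ι → ℕ := fun Q => ∑ i ∈ Q, wt (e k₀ i)
  set S : Finset (Finset ι) := univ.filter fun Q => ¬ (esPart μ Q H =ᵐ[P] 0) with hS
  have hSempty : S = ∅ := by
    by_contra hne
    obtain ⟨Q₀, hQ₀S, hmax⟩ := Finset.exists_max_image S ψ (Finset.nonempty_iff_ne_empty.2 hne)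
    have hQ₀ : ¬ (esPart μ Q₀ H =ᵐ[P] 0) := (Finset.mem_filter.1 hQ₀S).2
    set Q' := Q₀.image (e k₀) with hQ'
    -- (e1) a contributing `Q ∈ S` equals `Q₀`, with `e k = e k₀` on it
    have key : ∀ k Q, Q ∈ S → Q.image (e k) = Q' → (∀ i ∈ Q, e k i = e k₀ i) ∧ Q = Q₀ := by
      intro k Q hQS hQimg
      have h1 : ψ Q ≤ ψ Q₀ := hmax Q hQS
      have h2 : ∑ i ∈ Q, wt (e k i) = ψ Q₀ := by
        change _ = ∑ i ∈ Q₀, wt (e k₀ i)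
        rw [← Finset.sum_image (f := wt) fun i _ j _ h => he k h,
          ← Finset.sum_image (f := wt) fun i _ j _ h => he k₀ h, hQimg]
      have h3 : ∑ i ∈ Q, wt (e k i) ≤ ∑ i ∈ Q, wt (e k₀ i) := Finset.sum_le_sum fun i _ => hle k i
      have h4 : ∑ i ∈ Q, wt (e k i) = ∑ i ∈ Q, wt (e k₀ i) := le_antisymm h3 (h2 ▸ h1)
      have h5 : ∀ i ∈ Q, e k i = e k₀ i := fun i hi =>
        heq k i ((Finset.sum_eq_sum_iff_of_le fun j _ => hle k j).1 h4 i hi)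
      refine ⟨h5, Finset.image_injective (he k₀) ?_⟩
      calc Q.image (e k₀) = Q.image (e k) := Finset.image_congr fun i hi => (h5 i hi).symm
        _ = Q₀.image (e k₀) := by rw [hQimg, hQ']
    -- (e2) evaluate `h Q'` : the non-null part is `N • G k₀ Q₀`
    set N := (univ.filter fun k => Q₀.image (e k) = Q').card with hN
    have hN1 : 1 ≤ N := Finset.card_pos.2 ⟨k₀, Finset.mem_filter.2 ⟨Finset.mem_univ _, rfl⟩⟩
    have hnull : ∀ᵐ V ∂P', ∀ Q ∈ univ \ S, ∀ k ∈ (univ : Finset K), G k Q V = 0 := by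
      refine (Finset.eventually_all _).2 fun Q hQ => (Finset.eventually_all _).2 fun k _ => ?_
      have : esPart μ Q H =ᵐ[P] 0 := by
        by_contra hcon
        exact (Finset.mem_sdiff.1 hQ).2 (by rw [hS]; exact Finset.mem_filter.2 ⟨Finset.mem_univ _, hcon⟩)
      exact hGnull k Q this
    have hmain : ∀ᵐ V ∂P', h Q' V = N * G k₀ Q₀ V := by
      filter_upwards [hnull] with V hV
      change ∑ k, ∑ Q ∈ univ.filter (fun Q => Q.image (e k) = Q'), G k Q V = _
      have inner : ∀ k, ∑ Q ∈ univ.filter (fun Q => Q.image (e k) = Q'), G k Q V =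
          if Q₀.image (e k) = Q' then G k₀ Q₀ V else 0 := by
        intro k
        have hsplit : ∀ Q ∈ univ.filter (fun Q => Q.image (e k) = Q'), Q ≠ Q₀ → G k Q V = 0 := by
          intro Q hQ hne
          rw [Finset.mem_filter] at hQ
          by_cases hQS : Q ∈ S
          · exact absurd (key k Q hQS hQ.2).2 hne
          · exact hV Q (Finset.mem_sdiff.2 ⟨Finset.mem_univ _, hQS⟩) k (Finset.mem_univ _)
        split_ifs with hk
        · rw [Finset.sum_eq_single_of_mem Q₀ (Finset.mem_filter.2 ⟨Finset.mem_univ _, hk⟩) fun Q hQ hne => hsplit Q hQ hne]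
          -- same term: `e k = e k₀` on `Q₀`
          change esPart μ Q₀ H (V ∘ e k) = esPart μ Q₀ H (V ∘ e k₀)
          refine dependsOff_esPart (μ := μ) Q₀ H _ _ fun i hi => ?_
          have hiQ : i ∈ Q₀ := by
            by_contra h'
            exact hi (Finset.mem_sdiff.2 ⟨Finset.mem_univ _, h'⟩)
          simp only [Function.comp_apply, (key k Q₀ hQ₀S hk).1 i hiQ]
        · exact Finset.sum_eq_zero fun Q hQ => hsplit Q hQ (by
            rintro rfl
            exact hk (Finset.mem_filter.1 hQ).2)
      simp_rw [inner]
      rw [Finset.sum_ite, Finset.sum_const_zero, add_zero, Finset.sum_const, nsmul_eq_mul]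
    -- conclude: `G k₀ Q₀ = 0` a.e., contradiction
    have hG0 : G k₀ Q₀ =ᵐ[P'] 0 := by
      filter_upwards [hmain, hh0 Q'] with V h1 h2
      have : (N : ℝ) * G k₀ Q₀ V = 0 := by rw [← h1]; exact h2
      rcases mul_eq_zero.1 this with h | h
      · exfalso
        have : (1 : ℝ) ≤ N := by exact_mod_cast hN1
        linarith
      · exact h
    exact hQ₀ ((comp_ae_eq_zero_iff (he k₀) (measurable_esPart Q₀ hH) (abs_esPart_le Q₀ hC)).1 hG0)
  -- every part vanishes a.e., hence so does `H`
  have hall : ∀ᵐ x ∂P, ∀ Q ∈ (univ : Finset (Finset ι)), esPart μ Q H x = 0 := by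
    refine (Finset.eventually_all _).2 fun Q _ => ?_
    by_contra hQ
    have : Q ∈ S := Finset.mem_filter.2 ⟨Finset.mem_univ _, hQ⟩
    rw [hSempty] at this
    exact Finset.notMem_empty _ this
  filter_upwards [hall] with x hx
  rw [← sum_esPart (μ := μ) H x]
  exact Finset.sum_eq_zero hx

/-- **The omission lemma, run instance** (`r ≥ 1` columns of partial products per line `y ∈ Y`, spectators `Z`): if
`Σ_{k<r} H(V with column k omitted) = 0` for a.e. `V : (Y × Fin (r+1)) ⊕ Z → β`, then `H = 0` a.e.  Omitting column `k` is the pull-back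
along `Fin.succAbove k.castSucc` (so the last column `r` is never omitted). [folklore] -/
theorem ae_eq_zero_of_sum_omit_eq_zero {Y Z : Type*} [Fintype Y] [DecidableEq Y] [Fintype Z] [DecidableEq Z] {r : ℕ}
    (hr : 0 < r) {H : ((Y × Fin r) ⊕ Z → β) → ℝ} (hH : Measurable H) {C : ℝ} (hC : ∀ x, |H x| ≤ C)
    (hsum : (fun V : (Y × Fin (r + 1)) ⊕ Z → β =>
      ∑ k : Fin r, H (V ∘ Sum.map (Prod.map id (Fin.succAbove k.castSucc)) id)) =ᵐ[Measure.pi fun _ => μ] 0) :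
    H =ᵐ[Measure.pi fun _ => μ] 0 := by
  refine ae_eq_zero_of_sum_comp_eq_zero (fun k : Fin r => Sum.map (Prod.map id (Fin.succAbove k.castSucc)) id)
    (fun k => ?_) ⟨0, hr⟩ (Sum.elim (fun p => 2 ^ (p.2 : ℕ)) fun _ => 0) (fun k i => ?_) (fun k i h => ?_) hH hC hsum
  · exact (injective_id.prodMap Fin.succAbove_right_injective).sumMap injective_id
  · rcases i with ⟨y, c⟩ | z
    · simp only [Sum.map_inl, Prod.map_apply, id_eq, Sum.elim_inl]
      refine Nat.pow_le_pow_right (by norm_num) ?_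
      have h0 : (⟨0, hr⟩ : Fin r).castSucc = 0 := rfl
      rw [h0, Fin.succAbove_zero, Fin.val_succ]
      by_cases hlt : c.castSucc < k.castSucc
      · rw [Fin.succAbove_of_castSucc_lt _ _ hlt, Fin.val_castSucc]; omega
      · rw [Fin.succAbove_of_le_castSucc _ _ (not_lt.1 hlt), Fin.val_succ]
    · simp
  · rcases i with ⟨y, c⟩ | z
    · simp only [Sum.map_inl, Prod.map_apply, id_eq, Sum.elim_inl] at h
      have h0 : (⟨0, hr⟩ : Fin r).castSucc = 0 := rfl
      rw [h0, Fin.succAbove_zero] at h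
      have hv : ((k.castSucc.succAbove c : Fin (r + 1)) : ℕ) = (c.succ : ℕ) := Nat.pow_right_injective le_rfl h
      simp only [Sum.map_inl, Prod.map_apply, id_eq, h0, Fin.succAbove_zero]
      rw [Fin.ext hv]
    · simp

end Summit.QuantumFields.YangMills.Theorems.FlatTubeReduction.Omission
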